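import Summits.QuantumAdvantage.QuantumAdvantage.Theorems.LinnikCubicClassGroupsDegreeOnePrimesEscapeDivisionPNTBounds
import HarnessLib

/-!
# The division prime number theorem with an arbitrarily small exceptional window

Topic `Summits/QuantumAdvantage/QuantumAdvantage/Theorems`, cell B2b-1 (linnik-cubic), PART A (gen 10);
helper toward the crux `DegreeOnePrimesEscape` (stmt-QuantumAdvantage-11543) of route
`LinnikCubicClassGroups`.  HONEST FRAMING: the value of this file is a THEOREM (kernel-checked, GRH-free,
Siegel-free, no hypothesis) — NOT summit progress.

`division_PNT` (`…DivisionPNT.lean`) produces SOME window constant `c = c(n, ε) ≤ 1/4`: the exceptional case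
is "`ζ_N` has a real zero in `(1 − c/(log d + log 4), 1)`".  Here the window is made as small as one likes
(`division_PNT_window`): for every prescribed `c' > 0` the theorem holds with a window constant `c ≤ c'`
(and a larger exponent `L(n, ε, c')`), because a real zero `β ≤ 1 − c/(log d + log 4)` only contributes
`x^β/β ≤ ε x` once `x ≥ d^{L}`, `L ≫ 1/c`.  This is the form needed to exclude the exceptional case from a
zero-free interval `[1 − c₀, 1)` of the quadratic subfields (`…DivisionPNTQuadraticZeroFree.lean`).
[cite: LagariasMontgomeryOdlyzko1979, Theorem 1.1]
-/

noncomputable section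

open scoped NumberField nonZeroDivisors
open Finset Real Ideal NumberField
open Literature.NumberTheory.NumberFields Literature.NumberTheory.LFunctions
  Literature.NumberTheory.LFunctions.NumberField

namespace Summit.QuantumAdvantage.QuantumAdvantage.Theorems.DegreeOnePrimesEscape

/-- **A zero left of a window of constant `c` is harmless for `x ≥ d^L`, `L ≥ 3 log(4/ε₀)/c`**:
`x^β/β ≤ ε₀ x`. -/
theorem rpow_div_le_of_le_one_sub {c ε₀ d L x β : ℝ} (hc : 0 < c) (hε₀ : 0 < ε₀) (hε₀1 : ε₀ ≤ 1)
    (hd : 3 ≤ d) (hL : 3 * Real.log (4 / ε₀) / c ≤ L) (hx : d ^ L ≤ x) (hβ : 3 / 4 ≤ β)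
    (hβc : β ≤ 1 - c / (Real.log d + Real.log 4)) : x ^ β / β ≤ ε₀ * x := by
  have hd0 : 0 < d := by linarith
  have hd1 : 1 < d := by linarith
  have hlogd : 0 < Real.log d := Real.log_pos hd1
  have hlog4 : 0 < Real.log 4 := Real.log_pos (by norm_num)
  have hℓ : 0 < Real.log d + Real.log 4 := by linarith
  have hlog4' : Real.log 4 ≤ 2 * Real.log d := by
    rw [show (4:ℝ) = 2 ^ 2 by norm_num, Real.log_pow]; push_cast
    have := Real.log_le_log (by norm_num : (0:ℝ) < 2) (show (2:ℝ) ≤ d by linarith)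
    linarith
  have hx0 : 0 < x := lt_of_lt_of_le (Real.rpow_pos_of_pos hd0 L) hx
  have hl0 : 0 ≤ Real.log (4 / ε₀) := Real.log_nonneg (by rw [le_div_iff₀ hε₀]; linarith)
  have hL0 : 0 ≤ L := le_trans (div_nonneg (mul_nonneg (by norm_num) hl0) hc.le) hL
  have hx1 : 1 ≤ x := le_trans (Real.one_le_rpow hd1.le hL0) hx
  have hβ0 : 0 < β := by linarith
  have hlogx : L * Real.log d ≤ Real.log x := by
    have := Real.log_le_log (Real.rpow_pos_of_pos hd0 L) hx
    rwa [Real.log_rpow hd0] at this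
  -- `(c/ℓ) log x ≥ log(4/ε₀)`
  have hkey : Real.log (4 / ε₀) ≤ c / (Real.log d + Real.log 4) * Real.log x := by
    have h1 : c / (Real.log d + Real.log 4) * Real.log x ≥ c / (Real.log d + Real.log 4) * (L * Real.log d) :=
      mul_le_mul_of_nonneg_left hlogx (by positivity)
    have h2 : c / (Real.log d + Real.log 4) * (L * Real.log d) ≥
        c / (Real.log d + Real.log 4) * (3 * Real.log (4 / ε₀) / c * Real.log d) :=
      mul_le_mul_of_nonneg_left (mul_le_mul_of_nonneg_right hL hlogd.le) (by positivity)
    have h3 : c / (Real.log d + Real.log 4) * (3 * Real.log (4 / ε₀) / c * Real.log d) =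
        Real.log (4 / ε₀) * (3 * Real.log d / (Real.log d + Real.log 4)) := by
      field_simp
    have h4 : 1 ≤ 3 * Real.log d / (Real.log d + Real.log 4) := by
      rw [le_div_iff₀ hℓ]; linarith
    nlinarith
  have hxβ : x ^ β ≤ x * (ε₀ / 4) := by
    have e : x ^ β = x * Real.exp ((β - 1) * Real.log x) := by
      have : x ^ β = x ^ (1 : ℝ) * x ^ (β - 1) := by rw [← Real.rpow_add hx0]; ring_nf
      rw [this, Real.rpow_one, Real.rpow_def_of_pos hx0]; ring_nf
    rw [e]
    apply mul_le_mul_of_nonneg_left _ hx0.le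
    have h5 : (β - 1) * Real.log x ≤ -Real.log (4 / ε₀) := by
      have : (β - 1) * Real.log x ≤ -(c / (Real.log d + Real.log 4)) * Real.log x :=
        mul_le_mul_of_nonneg_right (by linarith) (Real.log_nonneg hx1)
      linarith
    calc Real.exp ((β - 1) * Real.log x) ≤ Real.exp (-Real.log (4 / ε₀)) := Real.exp_le_exp.mpr h5
      _ = ε₀ / 4 := by rw [Real.exp_neg, Real.exp_log (by positivity)]; field_simp
  rw [div_le_iff₀ hβ0]
  nlinarith [mul_pos hε₀ hx0]

set_option maxHeartbeats 1600000 in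
open scoped Classical in
/-- **The division prime number theorem with a prescribed window** (see the module docstring): for
`n > 1`, `0 < ε ≤ 1` and `c' > 0` there are `L > 0` and `0 < c ≤ min c' (1/4)` with the three-case
conclusion of `division_PNT` for the window `(1 − c/(log d + log 4), 1)`.  Unconditional.
[cite: LagariasMontgomeryOdlyzko1979, Theorem 1.1] -/
theorem division_PNT_window (n : ℕ) (hn : 1 < n) {ε : ℝ} (hε : 0 < ε) (hε1 : ε ≤ 1) {c' : ℝ} (hc' : 0 < c') :
    ∃ L c : ℝ, 0 < L ∧ 0 < c ∧ c ≤ c' ∧ c ≤ 1 / 4 ∧ ∀ (N : Type) [Field N] [NumberField N] [IsGalois ℚ N],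
      Module.finrank ℚ N = n → ∀ σ : N ≃ₐ[ℚ] N,
        ((¬ ∃ β₁ : ℝ, dedekindZeta₁ N β₁ = 0 ∧
            1 - c / (Real.log ((NumberField.discr N).natAbs : ℝ) + Real.log 4) < β₁ ∧ β₁ < 1) →
          ∀ x : ℝ, ((NumberField.discr N).natAbs : ℝ) ^ L ≤ x →
            |∑ p ∈ (Nat.primesLE ⌊x⌋₊).filter
                (fun p : ℕ => ¬ ((p : ℤ) ∣ NumberField.discr N) ∧
                  ∃ (Q : Ideal (𝓞 N)) (_ : Q.IsMaximal) (_ : Q.LiesOver (span {(p : ℤ)})) (φ g : N ≃ₐ[ℚ] N),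
                    IsArithFrobAt ℤ φ Q ∧ Q.inertia (N ≃ₐ[ℚ] N) = ⊥ ∧
                      Subgroup.zpowers (g * φ * g⁻¹) = Subgroup.zpowers σ), Real.log p -
              (Nat.card {τ : N ≃ₐ[ℚ] N // ∃ g : N ≃ₐ[ℚ] N,
                  Subgroup.zpowers (g * τ * g⁻¹) = Subgroup.zpowers σ} : ℝ) / Nat.card (N ≃ₐ[ℚ] N) * x| ≤
              ε * ((Nat.card {τ : N ≃ₐ[ℚ] N // ∃ g : N ≃ₐ[ℚ] N,
                  Subgroup.zpowers (g * τ * g⁻¹) = Subgroup.zpowers σ} : ℝ) / Nat.card (N ≃ₐ[ℚ] N) * x)) ∧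
        (∀ β₁ : ℝ, dedekindZeta₁ N β₁ = 0 →
          1 - c / (Real.log ((NumberField.discr N).natAbs : ℝ) + Real.log 4) < β₁ → β₁ < 1 →
          (dedekindZeta₁ (IntermediateField.fixedField (Subgroup.zpowers σ)) β₁ = 0 →
            ∀ x : ℝ, ((NumberField.discr N).natAbs : ℝ) ^ L ≤ x →
              0 < x - x ^ β₁ / β₁ ∧
              |∑ p ∈ (Nat.primesLE ⌊x⌋₊).filter
                  (fun p : ℕ => ¬ ((p : ℤ) ∣ NumberField.discr N) ∧
                    ∃ (Q : Ideal (𝓞 N)) (_ : Q.IsMaximal) (_ : Q.LiesOver (span {(p : ℤ)})) (φ g : N ≃ₐ[ℚ] N),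
                      IsArithFrobAt ℤ φ Q ∧ Q.inertia (N ≃ₐ[ℚ] N) = ⊥ ∧
                        Subgroup.zpowers (g * φ * g⁻¹) = Subgroup.zpowers σ), Real.log p -
                (Nat.card {τ : N ≃ₐ[ℚ] N // ∃ g : N ≃ₐ[ℚ] N,
                    Subgroup.zpowers (g * τ * g⁻¹) = Subgroup.zpowers σ} : ℝ) / Nat.card (N ≃ₐ[ℚ] N) *
                  (x - x ^ β₁ / β₁)| ≤
                ε * ((Nat.card {τ : N ≃ₐ[ℚ] N // ∃ g : N ≃ₐ[ℚ] N,
                    Subgroup.zpowers (g * τ * g⁻¹) = Subgroup.zpowers σ} : ℝ) / Nat.card (N ≃ₐ[ℚ] N) *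
                  (x - x ^ β₁ / β₁))) ∧
          (dedekindZeta₁ (IntermediateField.fixedField (Subgroup.zpowers σ)) β₁ ≠ 0 →
            ∀ x : ℝ, ((NumberField.discr N).natAbs : ℝ) ^ L ≤ x →
              |∑ p ∈ (Nat.primesLE ⌊x⌋₊).filter
                  (fun p : ℕ => ¬ ((p : ℤ) ∣ NumberField.discr N) ∧
                    ∃ (Q : Ideal (𝓞 N)) (_ : Q.IsMaximal) (_ : Q.LiesOver (span {(p : ℤ)})) (φ g : N ≃ₐ[ℚ] N),
                      IsArithFrobAt ℤ φ Q ∧ Q.inertia (N ≃ₐ[ℚ] N) = ⊥ ∧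
                        Subgroup.zpowers (g * φ * g⁻¹) = Subgroup.zpowers σ), Real.log p -
                (Nat.card {τ : N ≃ₐ[ℚ] N // ∃ g : N ≃ₐ[ℚ] N,
                    Subgroup.zpowers (g * τ * g⁻¹) = Subgroup.zpowers σ} : ℝ) / Nat.card (N ≃ₐ[ℚ] N) *
                  (x + x ^ β₁ / β₁)| ≤
                ε * ((Nat.card {τ : N ≃ₐ[ℚ] N // ∃ g : N ≃ₐ[ℚ] N,
                    Subgroup.zpowers (g * τ * g⁻¹) = Subgroup.zpowers σ} : ℝ) / Nat.card (N ≃ₐ[ℚ] N) *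
                  (x + x ^ β₁ / β₁)))) := by
  set ε₀ : ℝ := ε / 3 with hε₀
  have hε₀0 : 0 < ε₀ := by positivity
  have hε₀1 : ε₀ ≤ 1 := by rw [hε₀]; linarith
  have hε₀ε : ε₀ ≤ ε := by rw [hε₀]; linarith
  obtain ⟨L₀, c₀, hL₀, hc₀, hc₀4, h⟩ := division_PNT n hn hε₀0 hε₀1
  set c : ℝ := min c₀ c' with hcdef
  have hc0 : 0 < c := lt_min hc₀ hc'
  have hcc₀ : c ≤ c₀ := min_le_left _ _
  have hlog4ε : 0 < Real.log (4 / ε₀) := Real.log_pos (by rw [lt_div_iff₀ hε₀0]; linarith)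
  set L : ℝ := max L₀ (3 * Real.log (4 / ε₀) / c) with hL
  refine ⟨L, c, lt_of_lt_of_le hL₀ (le_max_left _ _), hc0, min_le_right _ _, hcc₀.trans hc₀4,
    fun N _ _ _ hN σ => ?_⟩
  obtain ⟨hA, hB⟩ := h N hN σ
  obtain ⟨hδ0, hδ1⟩ := divisionDensity_pos_le_one σ
  set δ : ℝ := (Nat.card {τ : N ≃ₐ[ℚ] N // ∃ g : N ≃ₐ[ℚ] N,
      Subgroup.zpowers (g * τ * g⁻¹) = Subgroup.zpowers σ} : ℝ) / Nat.card (N ≃ₐ[ℚ] N) with hδ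
  have hN1 : 1 < Module.finrank ℚ N := by rw [hN]; exact hn
  set d : ℝ := ((NumberField.discr N).natAbs : ℝ) with hd
  have hd3 : (3 : ℝ) ≤ d := three_le_natAbs_discr_real N hN1
  have hd1 : (1 : ℝ) ≤ d := by linarith
  have hℓ : 0 < Real.log d + Real.log 4 := by
    have := Real.log_pos (by linarith : (1:ℝ) < d); have := Real.log_pos (by norm_num : (1:ℝ) < 4); linarith
  -- the windows: `W(c) ⊆ W(c₀)`
  have hwin : ∀ β : ℝ, 1 - c / (Real.log d + Real.log 4) < β → 1 - c₀ / (Real.log d + Real.log 4) < β := by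
    intro β hβ
    have : c / (Real.log d + Real.log 4) ≤ c₀ / (Real.log d + Real.log 4) :=
      div_le_div_of_nonneg_right hcc₀ hℓ.le
    linarith
  have hxL : ∀ x : ℝ, d ^ L ≤ x → d ^ L₀ ≤ x := fun x hx =>
    (Real.rpow_le_rpow_of_exponent_le hd1 (le_max_left _ _)).trans hx
  refine ⟨?_, ?_⟩
  · -- (A) for the small window
    intro hexc x hx
    have hx₀ := hxL x hx
    have hx0 : 0 < x := lt_of_lt_of_le (Real.rpow_pos_of_pos (by linarith) L) hx
    have hδx : 0 ≤ δ * x := by positivity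
    by_cases hexc₀ : ∃ β₁ : ℝ, dedekindZeta₁ N β₁ = 0 ∧ 1 - c₀ / (Real.log d + Real.log 4) < β₁ ∧ β₁ < 1
    · -- a zero in the big window but not in the small one: `x^β₁/β₁ ≤ ε₀ x`
      obtain ⟨β₁, hζ₁, hβ₁c₀, hβ₁1⟩ := hexc₀
      have hβle : β₁ ≤ 1 - c / (Real.log d + Real.log 4) := by
        by_contra hlt; push Not at hlt
        exact hexc ⟨β₁, hζ₁, hlt, hβ₁1⟩
      have hβ34 : 3 / 4 ≤ β₁ := three_quarters_le_of_window hc₀ hc₀4 hd3 hβ₁c₀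
      have hβ0 : 0 < β₁ := by linarith
      have hy : x ^ β₁ / β₁ ≤ ε₀ * x :=
        rpow_div_le_of_le_one_sub hc0 hε₀0 hε₀1 hd3 (le_max_right _ _) hx hβ34 hβle
      have hy0 : 0 ≤ x ^ β₁ / β₁ := div_nonneg (Real.rpow_nonneg hx0.le _) hβ0.le
      have hδy : δ * (x ^ β₁ / β₁) ≤ δ * (ε₀ * x) := mul_le_mul_of_nonneg_left hy hδ0.le
      obtain ⟨hB1, hB2⟩ := hB β₁ hζ₁ hβ₁c₀ hβ₁1
      by_cases hζσ : dedekindZeta₁ (IntermediateField.fixedField (Subgroup.zpowers σ)) β₁ = 0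
      · obtain ⟨-, hb⟩ := hB1 hζσ x hx₀
        rw [abs_le] at hb ⊢
        constructor <;> nlinarith [hb.1, hb.2, mul_nonneg hδ0.le hy0]
      · have hb := hB2 hζσ x hx₀
        rw [abs_le] at hb ⊢
        constructor <;> nlinarith [hb.1, hb.2, mul_nonneg hδ0.le hy0]
    · have hb := hA hexc₀ x hx₀
      have : ε₀ * (δ * x) ≤ ε * (δ * x) := mul_le_mul_of_nonneg_right hε₀ε hδx
      exact hb.trans this
  · -- (B) for the small window: it lies in the big one
    intro β₁ hζ₁ hβ₁c hβ₁1
    obtain ⟨hB1, hB2⟩ := hB β₁ hζ₁ (hwin β₁ hβ₁c) hβ₁1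
    have hβ34 : 3 / 4 ≤ β₁ := three_quarters_le_of_window hc₀ hc₀4 hd3 (hwin β₁ hβ₁c)
    have hβ0 : 0 < β₁ := by linarith
    refine ⟨fun hζσ x hx => ?_, fun hζσ x hx => ?_⟩
    · obtain ⟨hxy, hb⟩ := hB1 hζσ x (hxL x hx)
      refine ⟨hxy, hb.trans ?_⟩
      exact mul_le_mul_of_nonneg_right hε₀ε (mul_nonneg hδ0.le hxy.le)
    · have hb := hB2 hζσ x (hxL x hx)
      refine hb.trans (mul_le_mul_of_nonneg_right hε₀ε (mul_nonneg hδ0.le ?_))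
      have hx0 : 0 < x := lt_of_lt_of_le (Real.rpow_pos_of_pos (by linarith) L) hx
      have : 0 ≤ x ^ β₁ / β₁ := div_nonneg (Real.rpow_nonneg hx0.le _) hβ0.le
      linarith

end Summit.QuantumAdvantage.QuantumAdvantage.Theorems.DegreeOnePrimesEscape

end
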